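import Literature.Analysis.FluidPDE.PineauVicolPressureDecayClass
import HarnessLib

/-!
# Duality bounds for the pressure potential on the Type I decay class (Pineau–Vicol 2026, towards Lemma 2.1 / 7.1)

Analysis/FluidPDE support file (all results proved; no named facts), sequel of
`PineauVicolPressureDecayClass` in the discharge programme of
`Literature.Analysis.FluidPDE.pineauVicol2026_rdss_liouville` (B. Pineau, V. Vicol,
arXiv:2607.09619 (2026), Thm. 1.7). The pressure identification `∇p = ∇Q[u(t)]` for classical
Type I solutions follows Tao's probe argument (Tao 2011, proof of Lemma 4.1 (i); the tree's
`NormalisedPressureDischarge` for finite energy). Its pressure term needs the duality/dilation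
bound `|∫ Q[v] ψ(R⁻¹(· − x₀))| → 0` after the probe normalisation `R⁻⁴`; for the decay class
`(1+|y|)|v(y)| ≤ C` (infinite energy) this file proves the substitute
`|∫ Q[v](x) ψ(R⁻¹(x − x₀)) dx| ≤ M_ψ C² R³` (`R ≥ 1`):

* `pressurePotential_eq_scale_decay`: independence of the cutoff scale, `Q = −Q₁^R − Q₂^R`
  (cutoff radii `(R, 2R)`), for the decay class;
* `exists_bound_farPotential_scale_decay`: `|Q₂^{R,2R}[v](x)| ≤ K C²` uniformly in `R ≥ 1`
  and `x` (near `x`: `‖D²Γ∞^R‖ ≤ m R⁻³` on a ball of volume `∼ R³`; far: `‖D²Γ(z)‖ ≤ M|z|⁻³`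
  by homogeneity and AM–GM against `(1+|y|)⁻²`);
* `exists_abs_integral_pressurePotential_mul_le_decay`: the bound above — far part by the
  uniform bound against `‖ψ_R‖₁ = R³‖ψ‖₁`, near part by Fubini and two integrations by parts
  with the **local** energy `∫_{B(x₀,(r_ψ+2)R)} |v|² ≤ C² |B₁| (r_ψ+2)³ R³` in place of the
  energy.

## References

* B. Pineau, V. Vicol, arXiv:2607.09619 (2026), Lemma 2.1 (p. 9–10), Lemma 7.1. [PineauVicol2026]
* T. Tao, *Localisation and compactness properties of the Navier–Stokes global regularity
  problem*, Anal. PDE 6 (2013), §4, proof of Lemma 4.1 (i). [Tao2011]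
-/

noncomputable section

open MeasureTheory Set Filter Metric Topology InnerProductSpace Function
open scoped RealInnerProductSpace Laplacian ContDiff ENNReal

namespace Literature.Analysis.FluidPDE

namespace PineauVicol2026

open Literature.Analysis.FluidPDE.FourierNS (HasDecay)

/-- Local notation for physical space `ℝ³ = EuclideanSpace ℝ (Fin 3)`. -/
local notation "ℝ³" => EuclideanSpace ℝ (Fin 3)

section Duality

-- nested operator types `ℝ³ →L[ℝ] ℝ³ →L[ℝ] ℝ³ →L[ℝ] ℝ³ →L[ℝ] ℝ`
set_option maxSynthPendingDepth 3

variable {r₀ r₁ : ℝ}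

/-- The far integrand `y ↦ D²Γ∞(x − y)(v y, v y)` is integrable for the decay class. [folklore] -/
theorem integrable_farPotential_integrand_decay (h₀ : 0 < r₀) (h₁ : r₀ < r₁) {v : ℝ³ → ℝ³}
    (hvc : Continuous v) {C : ℝ} (hv : ∀ y, ‖v y‖ ≤ C / (1 + ‖y‖)) (x : ℝ³) :
    Integrable fun y => fderiv ℝ (fderiv ℝ (newtonFar r₀ r₁)) (x - y) (v y) (v y) := by
  obtain ⟨⟨M₀, hM₀⟩, -, -⟩ := exists_hasDecay_fderiv_newtonFar h₀ h₁
  have h := integrable_clm_apply_comp_sub_decay (L := fun y => evalDiag (v y))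
    (contDiff_fderiv2_newtonFar h₀ h₁).continuous hM₀ (continuous_evalDiag.comp hvc) (hasDecay_two_evalDiag hv) x
  exact h

/-- **Independence of the cutoff scale for the decay class**: `Q[v] = −Q₁^R[v] − Q₂^R[v]` with
cutoff radii `(R, 2R)`, `R > 0`, for `v ∈ C²` with `(1+|y|)|v(y)| ≤ C`
(as `pressurePotential_eq_scale`). [folklore] -/
theorem pressurePotential_eq_scale_decay {R : ℝ} (hR : 0 < R) {v : ℝ³ → ℝ³} (hv2 : ContDiff ℝ 2 v)
    {C : ℝ} (hv : ∀ y, ‖v y‖ ≤ C / (1 + ‖y‖)) (x : ℝ³) :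
    pressurePotential v x = -nearPotential (R * 1) (R * 2) v x - farPotential (R * 1) (R * 2) v x := by
  have hR1 : 0 < R * 1 := by linarith
  have hR2 : R * 1 < R * 2 := by linarith
  set Ψ : ℝ³ → ℝ := fun z => newtonFar 1 2 z - newtonFar (R * 1) (R * 2) z with hΨ
  have hΨs : ContDiff ℝ 2 Ψ := (contDiff_newtonFar one_pos one_lt_two).sub
    (contDiff_newtonFar hR1 hR2)
  have hΨc : HasCompactSupport Ψ := by
    refine HasCompactSupport.intro (isCompact_closedBall (0 : ℝ³) (max 2 (R * 2))) fun z hz => ?_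
    rw [mem_closedBall_zero_iff, not_le, max_lt_iff] at hz
    simp only [hΨ]
    rw [newtonFar_eq_newtonKernel zero_le_one one_lt_two hz.1.le,
      newtonFar_eq_newtonKernel hR1.le hR2 hz.2.le, sub_self]
  have h1 : nearPotential (R * 1) (R * 2) v x - nearPotential 1 2 v x =
      ∫ z, Ψ z * pressureSource v (x - z) := by
    rw [nearPotential, nearPotential, ← integral_sub
      (integrable_nearPotential_integrand hR1.le hR2 hv2 x)
      (integrable_nearPotential_integrand zero_le_one one_lt_two hv2 x)]
    refine integral_congr_ae (Eventually.of_forall fun z => ?_)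
    simp only [hΨ]
    rw [← sub_mul, newtonNear_sub_newtonNear]
  have h2 : ∫ z, Ψ z * pressureSource v (x - z) =
      farPotential 1 2 v x - farPotential (R * 1) (R * 2) v x := by
    rw [← integral_sub_left_eq_self (fun z => Ψ z * pressureSource v (x - z)) volume x]
    simp only [sub_sub_cancel]
    rw [integral_comp_sub_mul_pressureSource hΨs hΨc hv2 x, farPotential, farPotential,
      ← integral_sub (integrable_farPotential_integrand_decay one_pos one_lt_two hv2.continuous hv x)
        (integrable_farPotential_integrand_decay hR1 hR2 hv2.continuous hv x)]
    refine integral_congr_ae (Eventually.of_forall fun y => ?_)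
    dsimp only
    rw [fderiv2_sub (contDiff_newtonFar one_pos one_lt_two) (contDiff_newtonFar hR1 hR2)]
    rfl
  rw [pressurePotential]
  linarith [h1, h2]

/-- `(1 + |y|)⁻ᵏ` is integrable on `ℝ³` for `k ≥ 4`. [folklore] -/
theorem integrable_inv_one_add_norm_pow {k : ℕ} (hk : 4 ≤ k) : Integrable fun y : ℝ³ => ((1 + ‖y‖) ^ k)⁻¹ := by
  have h := integrable_one_add_norm (E := ℝ³) (μ := volume) (r := k) (by
    simp only [finrank_euclideanSpace, Fintype.card_fin, Nat.cast_ofNat]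
    exact_mod_cast (show 3 < k by omega))
  refine h.congr (Eventually.of_forall fun y => ?_)
  have h0 : 0 < 1 + ‖y‖ := by positivity
  show (1 + ‖y‖) ^ (-(k : ℝ)) = ((1 + ‖y‖) ^ k)⁻¹
  rw [Real.rpow_neg h0.le, Real.rpow_natCast]

/-- **The far potential at scale `(R, 2R)` is uniformly bounded on the decay class**: there is a
universal `K` with `|Q₂^{R,2R}[v](x)| ≤ K C²` for all `R ≥ 1`, `x`, and `v` continuous with
`(1+|y|)|v(y)| ≤ C` (near `x`: `‖D²Γ∞^{R,2R}‖ ≤ m R⁻³` against `|v|² ≤ C²` on a ball of volume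
`∼R³`; far from `x`: `‖D²Γ(z)‖ ≤ M|z|⁻³` and `|z|⁻³(1+|y|)⁻² ≤ ½((3/2)⁶(1+|z|)⁻⁶ + (1+|y|)⁻⁴)`).
[folklore] -/
theorem exists_bound_farPotential_scale_decay :
    ∃ K : ℝ, 0 ≤ K ∧ ∀ (v : ℝ³ → ℝ³) (C : ℝ), Continuous v → (∀ y, ‖v y‖ ≤ C / (1 + ‖y‖)) →
      ∀ (R : ℝ), 1 ≤ R → ∀ x : ℝ³, |farPotential (R * 1) (R * 2) v x| ≤ K * C ^ 2 := by
  -- constants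
  obtain ⟨m₂, -, -, hm₂, -, -⟩ := exists_bounds_fderiv2_newtonFar (r₀ := (1 : ℝ)) (r₁ := 2) one_pos one_lt_two
  have hm₂0 : 0 ≤ m₂ := (norm_nonneg _).trans (hm₂ 0)
  obtain ⟨M2, hM20, hM2⟩ := exists_decay_of_homogeneous _ (-3) (by norm_num) fderiv2_newtonKernel_homogeneous
    (contDiffOn_fderiv2_newtonKernel (n := 0)).continuousOn
  set V₁ : ℝ := volume.real (Metric.ball (0 : ℝ³) 1) with hV₁
  have hV₁0 : 0 ≤ V₁ := measureReal_nonneg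
  set K₆ : ℝ := ∫ y : ℝ³, ((1 + ‖y‖) ^ 6)⁻¹ with hK₆
  set K₄ : ℝ := ∫ y : ℝ³, ((1 + ‖y‖) ^ 4)⁻¹ with hK₄
  have hK₆0 : 0 ≤ K₆ := integral_nonneg fun y => by positivity
  have hK₄0 : 0 ≤ K₄ := integral_nonneg fun y => by positivity
  refine ⟨8 * m₂ * V₁ + M2 / 2 * ((3 / 2) ^ 6 * K₆ + K₄), by positivity, fun v C hvc hv R hR x => ?_⟩
  have hR0 : 0 < R := one_pos.trans_le hR
  have hC : 0 ≤ C := by have := (norm_nonneg _).trans (hv 0); simpa using this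
  have hR1 : 0 < R * 1 := by linarith
  have hR2 : R * 1 < R * 2 := by linarith
  -- kernel bounds at scale `R`
  have hkerR : ∀ z, ‖fderiv ℝ (fderiv ℝ (newtonFar (R * 1) (R * 2))) z‖ ≤ R⁻¹ ^ 3 * m₂ :=
    norm_fderiv2_newtonFar_scale_le hR0 hm₂
  have hkerFar : ∀ z, 2 * R < ‖z‖ → ‖fderiv ℝ (fderiv ℝ (newtonFar (R * 1) (R * 2))) z‖ ≤ M2 * ‖z‖ ^ (-3 : ℤ) := by
    intro z hz
    rw [(newtonFar_fderiv_iterates_eq hR1.le hR2 (by linarith)).2.2.1]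
    exact hM2 z (by linarith)
  -- the dominator
  set g : ℝ³ → ℝ := fun y => R⁻¹ ^ 3 * m₂ * C ^ 2 * (Metric.closedBall x (2 * R)).indicator (fun _ => (1 : ℝ)) y +
    M2 / 2 * C ^ 2 * ((3 / 2) ^ 6 * ((1 + ‖x - y‖) ^ 6)⁻¹ + ((1 + ‖y‖) ^ 4)⁻¹) with hg
  have hball_fin : volume (Metric.closedBall x (2 * R)) < ⊤ := measure_closedBall_lt_top
  have hgi : Integrable g := by
    refine (((integrableOn_const hball_fin.ne (C := (1 : ℝ))).integrable_indicator measurableSet_closedBall).const_mul _).add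
      ((((integrable_inv_one_add_norm_pow (k := 6) (by norm_num)).comp_sub_left x |>.const_mul _).add
        (integrable_inv_one_add_norm_pow (k := 4) le_rfl)).const_mul _)
  -- pointwise domination of the integrand
  have hpt : ∀ y, ‖fderiv ℝ (fderiv ℝ (newtonFar (R * 1) (R * 2))) (x - y) (v y) (v y)‖ ≤ g y := by
    intro y
    have hvy : ‖v y‖ ^ 2 ≤ C ^ 2 / (1 + ‖y‖) ^ 2 := by
      rw [← div_pow]; exact pow_le_pow_left₀ (norm_nonneg _) (hv y) 2
    have h1y : 0 < 1 + ‖y‖ := by positivity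
    have hvy' : ‖v y‖ ^ 2 ≤ C ^ 2 := hvy.trans (div_le_self (sq_nonneg _) (one_le_pow₀ (by linarith [norm_nonneg y])))
    have hbase : ‖fderiv ℝ (fderiv ℝ (newtonFar (R * 1) (R * 2))) (x - y) (v y) (v y)‖ ≤
        ‖fderiv ℝ (fderiv ℝ (newtonFar (R * 1) (R * 2))) (x - y)‖ * ‖v y‖ ^ 2 := by
      calc _ ≤ ‖fderiv ℝ (fderiv ℝ (newtonFar (R * 1) (R * 2))) (x - y) (v y)‖ * ‖v y‖ :=
            ContinuousLinearMap.le_opNorm _ _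
        _ ≤ ‖fderiv ℝ (fderiv ℝ (newtonFar (R * 1) (R * 2))) (x - y)‖ * ‖v y‖ * ‖v y‖ := by
            gcongr; exact ContinuousLinearMap.le_opNorm _ _
        _ = _ := by ring
    have hg2 : 0 ≤ M2 / 2 * C ^ 2 * ((3 / 2) ^ 6 * ((1 + ‖x - y‖) ^ 6)⁻¹ + ((1 + ‖y‖) ^ 4)⁻¹) := by positivity
    by_cases hy : y ∈ Metric.closedBall x (2 * R)
    · -- near: kernel `≤ R⁻³ m₂`, weight `≤ C²`
      have : ‖fderiv ℝ (fderiv ℝ (newtonFar (R * 1) (R * 2))) (x - y)‖ * ‖v y‖ ^ 2 ≤ R⁻¹ ^ 3 * m₂ * C ^ 2 :=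
        mul_le_mul (hkerR _) hvy' (sq_nonneg _) (by positivity)
      have hgy : g y = R⁻¹ ^ 3 * m₂ * C ^ 2 +
          M2 / 2 * C ^ 2 * ((3 / 2) ^ 6 * ((1 + ‖x - y‖) ^ 6)⁻¹ + ((1 + ‖y‖) ^ 4)⁻¹) := by
        rw [hg]; dsimp only; rw [Set.indicator_of_mem hy, mul_one]
      rw [hgy]
      linarith [hbase]
    · -- far: kernel `≤ M2 |x−y|⁻³`, AM–GM
      have hxy : 2 * R < ‖x - y‖ := by
        rw [Metric.mem_closedBall, dist_comm, dist_eq_norm, not_le] at hy; exact hy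
      have hxy2 : 2 ≤ ‖x - y‖ := by linarith
      have hk := hkerFar (x - y) hxy
      have hz3 : ‖x - y‖ ^ (-3 : ℤ) = (‖x - y‖ ^ 3)⁻¹ := by
        rw [show (-3 : ℤ) = -((3 : ℕ) : ℤ) by norm_num, zpow_neg, zpow_natCast]
      rw [hz3] at hk
      -- `(|x−y|³)⁻¹ ≤ (3/2)³ (1+|x−y|)⁻³`
      have h1xy : 0 < 1 + ‖x - y‖ := by positivity
      have hcmp : (‖x - y‖ ^ 3)⁻¹ ≤ (3 / 2) ^ 3 * ((1 + ‖x - y‖) ^ 3)⁻¹ := by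
        have hle : (1 + ‖x - y‖) ^ 3 ≤ ((3 / 2) * ‖x - y‖) ^ 3 :=
          pow_le_pow_left₀ h1xy.le (by linarith) 3
        rw [inv_eq_one_div, inv_eq_one_div, mul_one_div, div_le_div_iff₀ (by positivity) (by positivity), one_mul]
        calc (1 + ‖x - y‖) ^ 3 ≤ ((3 / 2) * ‖x - y‖) ^ 3 := hle
          _ = (3 / 2) ^ 3 * ‖x - y‖ ^ 3 := by ring
      -- AM–GM: `a b ≤ ½ (a² + b²)` with `a = (3/2)³(1+|x−y|)⁻³`, `b = (1+|y|)⁻²`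
      set a : ℝ := (3 / 2) ^ 3 * ((1 + ‖x - y‖) ^ 3)⁻¹ with ha
      set b : ℝ := ((1 + ‖y‖) ^ 2)⁻¹ with hb
      have hab : a * b ≤ (1 / 2) * (a ^ 2 + b ^ 2) := by nlinarith [sq_nonneg (a - b)]
      have ha2 : a ^ 2 = (3 / 2) ^ 6 * ((1 + ‖x - y‖) ^ 6)⁻¹ := by
        rw [ha, mul_pow, inv_pow, ← pow_mul, ← pow_mul]
      have hb2 : b ^ 2 = ((1 + ‖y‖) ^ 4)⁻¹ := by rw [hb, inv_pow, ← pow_mul]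
      have hgy : g y = M2 / 2 * C ^ 2 * ((3 / 2) ^ 6 * ((1 + ‖x - y‖) ^ 6)⁻¹ + ((1 + ‖y‖) ^ 4)⁻¹) := by
        rw [hg]; dsimp only; rw [Set.indicator_of_notMem hy, mul_zero, zero_add]
      rw [hgy]
      calc ‖fderiv ℝ (fderiv ℝ (newtonFar (R * 1) (R * 2))) (x - y) (v y) (v y)‖
          ≤ ‖fderiv ℝ (fderiv ℝ (newtonFar (R * 1) (R * 2))) (x - y)‖ * ‖v y‖ ^ 2 := hbase
        _ ≤ (M2 * (‖x - y‖ ^ 3)⁻¹) * (C ^ 2 / (1 + ‖y‖) ^ 2) :=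
            mul_le_mul hk hvy (sq_nonneg _) (by positivity)
        _ ≤ (M2 * a) * (C ^ 2 * b) := by
            rw [hb, div_eq_mul_inv]
            exact mul_le_mul_of_nonneg_right (mul_le_mul_of_nonneg_left hcmp hM20) (by positivity)
        _ = M2 * C ^ 2 * (a * b) := by ring
        _ ≤ M2 * C ^ 2 * ((1 / 2) * (a ^ 2 + b ^ 2)) := mul_le_mul_of_nonneg_left hab (by positivity)
        _ = M2 / 2 * C ^ 2 * ((3 / 2) ^ 6 * ((1 + ‖x - y‖) ^ 6)⁻¹ + ((1 + ‖y‖) ^ 4)⁻¹) := by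
            rw [ha2, hb2]; ring
  -- integrate
  have hvol : volume.real (Metric.closedBall x (2 * R)) = (2 * R) ^ 3 * V₁ := by
    rw [hV₁, measureReal_def, measureReal_def, Measure.addHaar_closedBall volume x (by positivity : (0:ℝ) ≤ 2 * R),
      ENNReal.toReal_mul, ENNReal.toReal_ofReal (by positivity)]
    simp
  have hK₆' : ∫ y : ℝ³, ((1 + ‖x - y‖) ^ 6)⁻¹ = K₆ := by
    rw [hK₆]; exact integral_sub_left_eq_self (fun z : ℝ³ => ((1 + ‖z‖) ^ 6)⁻¹) volume x
  have hI1i : Integrable (fun y : ℝ³ => R⁻¹ ^ 3 * m₂ * C ^ 2 * (Metric.closedBall x (2 * R)).indicator (fun _ => (1 : ℝ)) y) :=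
    ((integrableOn_const hball_fin.ne (C := (1 : ℝ))).integrable_indicator measurableSet_closedBall).const_mul _
  have hI2i : Integrable (fun y : ℝ³ => M2 / 2 * C ^ 2 * ((3 / 2) ^ 6 * ((1 + ‖x - y‖) ^ 6)⁻¹ + ((1 + ‖y‖) ^ 4)⁻¹)) :=
    ((((integrable_inv_one_add_norm_pow (k := 6) (by norm_num)).comp_sub_left x).const_mul _).add
      (integrable_inv_one_add_norm_pow (k := 4) le_rfl)).const_mul _
  have hI1 : ∫ y : ℝ³, R⁻¹ ^ 3 * m₂ * C ^ 2 * (Metric.closedBall x (2 * R)).indicator (fun _ => (1 : ℝ)) y =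
      R⁻¹ ^ 3 * m₂ * C ^ 2 * ((2 * R) ^ 3 * V₁) := by
    rw [integral_const_mul, integral_indicator measurableSet_closedBall, setIntegral_const, smul_eq_mul, mul_one, hvol]
  have hI2 : ∫ y : ℝ³, M2 / 2 * C ^ 2 * ((3 / 2) ^ 6 * ((1 + ‖x - y‖) ^ 6)⁻¹ + ((1 + ‖y‖) ^ 4)⁻¹) =
      M2 / 2 * C ^ 2 * ((3 / 2) ^ 6 * K₆ + K₄) := by
    have i6 : Integrable (fun y : ℝ³ => (3 / 2 : ℝ) ^ 6 * ((1 + ‖x - y‖) ^ 6)⁻¹) :=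
      ((integrable_inv_one_add_norm_pow (k := 6) (by norm_num)).comp_sub_left x).const_mul _
    have i4 : Integrable (fun y : ℝ³ => ((1 + ‖y‖) ^ 4)⁻¹) := integrable_inv_one_add_norm_pow (k := 4) le_rfl
    rw [integral_const_mul, integral_add i6 i4, integral_const_mul, hK₆']
  have hint_g : ∫ y, g y = R⁻¹ ^ 3 * m₂ * C ^ 2 * ((2 * R) ^ 3 * V₁) + M2 / 2 * C ^ 2 * ((3 / 2) ^ 6 * K₆ + K₄) := by
    rw [hg]; dsimp only
    rw [integral_add hI1i hI2i, hI1, hI2]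
  calc |farPotential (R * 1) (R * 2) v x| = ‖∫ y, fderiv ℝ (fderiv ℝ (newtonFar (R * 1) (R * 2))) (x - y) (v y) (v y)‖ := by
        rw [Real.norm_eq_abs]; rfl
    _ ≤ ∫ y, g y := norm_integral_le_of_norm_le hgi (Eventually.of_forall hpt)
    _ = R⁻¹ ^ 3 * m₂ * C ^ 2 * ((2 * R) ^ 3 * V₁) + M2 / 2 * C ^ 2 * ((3 / 2) ^ 6 * K₆ + K₄) := hint_g
    _ = (8 * m₂ * V₁ + M2 / 2 * ((3 / 2) ^ 6 * K₆ + K₄)) * C ^ 2 := by field_simp; ring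

/-- **The duality/dilation bound on the decay class.** For a `C²` compactly supported test
function `ψ` there is `M_ψ` with
`|∫ Q[v](x) ψ(R⁻¹(x − x₀)) dx| ≤ M_ψ C² R³` for all `R ≥ 1`, `x₀`, and `v ∈ C²` with
`(1+|y|)|v(y)| ≤ C` (as `abs_integral_pressurePotential_mul_le`, with the finite energy replaced
by the local energy `∫_{B(x₀, ρR)} |v|² ≤ C² |B| ρ³R³` in the near part and by the uniform bound
of `exists_bound_farPotential_scale_decay` in the far part). In the probe of the pressure
identification this is multiplied by the normalisation `R⁻⁴` of `∂χ_R`, hence is `O(1/R)`.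
[cite: Tao2011, §4, proof of Lemma 4.1 (i)] -/
theorem exists_abs_integral_pressurePotential_mul_le_decay {ψ : ℝ³ → ℝ} (hψ : ContDiff ℝ 2 ψ)
    (hψc : HasCompactSupport ψ) :
    ∃ M : ℝ, 0 ≤ M ∧ ∀ (v : ℝ³ → ℝ³) (C : ℝ), ContDiff ℝ 2 v → (∀ y, ‖v y‖ ≤ C / (1 + ‖y‖)) →
      ∀ (x₀ : ℝ³) (R : ℝ), 1 ≤ R →
        |∫ x, pressurePotential v x * ψ (R⁻¹ • (x - x₀))| ≤ M * C ^ 2 * R ^ 3 := by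
  -- the constants
  obtain ⟨Kf, hKf0, hKf⟩ := exists_bound_farPotential_scale_decay
  obtain ⟨D₂, hD₂⟩ := ((hψ.fderiv_right (m := 1) le_rfl).continuous_fderiv
    one_ne_zero).bounded_above_of_compact_support ((hψc.fderiv (𝕜 := ℝ)).fderiv (𝕜 := ℝ))
  have hD₂0 : 0 ≤ D₂ := (norm_nonneg _).trans (hD₂ 0)
  obtain ⟨rψ, hrψ⟩ := hψc.isCompact.isBounded.subset_closedBall 0
  set rψ' : ℝ := max rψ 0 with hrψ'
  have hrψ'0 : 0 ≤ rψ' := le_max_right _ _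
  have hsuppψ : tsupport ψ ⊆ closedBall (0 : ℝ³) rψ' := hrψ.trans (closedBall_subset_closedBall (le_max_left _ _))
  set N₁ : ℝ := ∫ w, |newtonNear (1 : ℝ) 2 w| with hN₁
  have hN₁0 : 0 ≤ N₁ := integral_nonneg fun w => abs_nonneg _
  set Pψ : ℝ := ∫ w, |ψ w| with hPψ
  have hPψ0 : 0 ≤ Pψ := integral_nonneg fun w => abs_nonneg _
  set V₁ : ℝ := volume.real (Metric.closedBall (0 : ℝ³) 1) with hV₁
  have hV₁0 : 0 ≤ V₁ := measureReal_nonneg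
  refine ⟨Kf * Pψ + N₁ * D₂ * ((rψ' + 2) ^ 3 * V₁), by positivity, fun v C hv2 hv x₀ R hRge => ?_⟩
  have hR : 0 < R := one_pos.trans_le hRge
  have hvc : Continuous v := hv2.continuous
  have hC : 0 ≤ C := by have := (norm_nonneg _).trans (hv 0); simpa using this
  have hR1 : 0 < R * 1 := by linarith
  have hR2 : R * 1 < R * 2 := by linarith
  -- the dilated test function
  set ψR : ℝ³ → ℝ := fun x => ψ (R⁻¹ • (x - x₀)) with hψR
  have hψRs : ContDiff ℝ 2 ψR := hψ.comp ((contDiff_id.sub contDiff_const).const_smul _)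
  have hψRc : HasCompactSupport ψR := hasCompactSupport_comp_inv_smul_sub hψc hR x₀
  have hψRcont : Continuous ψR := hψRs.continuous
  have hD2ψR : ∀ x, ‖fderiv ℝ (fderiv ℝ ψR) x‖ ≤ R⁻¹ ^ 2 * D₂ := fun x => by
    rw [hψR, fderiv2_comp_inv_smul_sub ψ hR, norm_smul, norm_pow, norm_inv, Real.norm_eq_abs,
      abs_of_pos hR]
    exact mul_le_mul_of_nonneg_left (hD₂ _) (by positivity)
  have hψR1 : ∫ x, |ψR x| = R ^ 3 * Pψ := integral_abs_comp_inv_smul_sub ψ hR x₀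
  -- the support of `ψR` and of its second derivative
  have hsuppR : tsupport ψR ⊆ closedBall x₀ (R * rψ') := by
    refine closure_minimal (fun x hx => ?_) isClosed_closedBall
    rw [mem_closedBall, dist_eq_norm]
    have hx' : R⁻¹ • (x - x₀) ∈ tsupport ψ := subset_closure hx
    have := mem_closedBall_zero_iff.1 (hsuppψ hx')
    rw [norm_smul, norm_inv, Real.norm_eq_abs, abs_of_pos hR] at this
    rwa [inv_mul_le_iff₀ hR] at this
  have hsuppD2 : ∀ x, x ∉ closedBall x₀ (R * rψ') → fderiv ℝ (fderiv ℝ ψR) x = 0 := fun x hx =>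
    image_eq_zero_of_notMem_tsupport fun h => hx (hsuppR (tsupport_fderiv_subset ℝ (tsupport_fderiv_subset ℝ h)))
  -- the source and the potentials at scale `R`
  set G := pressureSource v with hG
  have hGc : Continuous G := (contDiff_pressureSource (n := 0) (by exact_mod_cast hv2)).continuous
  set Q₁ := nearPotential (R * 1) (R * 2) v with hQ₁
  set Q₂ := farPotential (R * 1) (R * 2) v with hQ₂
  have hQ₁c : Continuous Q₁ :=
    (contDiff_nearPotential hR1.le hR2 0 (by exact_mod_cast hv2)).continuous
  have hQ₂c : Continuous Q₂ := (contDiff_farPotential_decay hR1 hR2 hvc hv).1.continuous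
  have hQ : (fun x => pressurePotential v x * ψR x) = fun x => -(Q₁ x * ψR x) - Q₂ x * ψR x := by
    funext x
    rw [pressurePotential_eq_scale_decay hR hv2 hv x]
    ring
  have iQ₁ : Integrable fun x => Q₁ x * ψR x :=
    (hQ₁c.mul hψRcont).integrable_of_hasCompactSupport hψRc.mul_left
  have iQ₂ : Integrable fun x => Q₂ x * ψR x :=
    (hQ₂c.mul hψRcont).integrable_of_hasCompactSupport hψRc.mul_left
  -- the far part: `|Q₂| ≤ Kf C²` against `‖ψR‖₁ = R³ Pψ`
  have hfar : |∫ x, Q₂ x * ψR x| ≤ Kf * Pψ * C ^ 2 * R ^ 3 := by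
    have hpt : ∀ x, |Q₂ x| ≤ Kf * C ^ 2 := fun x => hKf v C hvc hv R hRge x
    calc |∫ x, Q₂ x * ψR x| ≤ ∫ x, Kf * C ^ 2 * |ψR x| := by
          rw [← Real.norm_eq_abs]
          refine norm_integral_le_of_norm_le ((hψRcont.abs.integrable_of_hasCompactSupport
            hψRc.abs).const_mul _) (Eventually.of_forall fun x => ?_)
          rw [Real.norm_eq_abs, abs_mul]
          exact mul_le_mul_of_nonneg_right (hpt x) (abs_nonneg _)
      _ = Kf * Pψ * C ^ 2 * R ^ 3 := by
          rw [integral_const_mul, hψR1]; ring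
  -- the near part: Fubini and two integrations by parts, with the local energy
  have hnear : |∫ x, Q₁ x * ψR x| ≤ N₁ * D₂ * ((rψ' + 2) ^ 3 * V₁) * C ^ 2 * R ^ 3 := by
    -- a bound for `G` on the relevant compact set
    have hK : IsCompact (tsupport ψR ×ˢ closedBall (0 : ℝ³) (R * 2)) :=
      hψRc.isCompact.prod (isCompact_closedBall _ _)
    obtain ⟨CG, hCG⟩ := (hK.image (continuous_fst.sub continuous_snd)).exists_bound_of_continuousOn
      hGc.continuousOn
    have hCG' : ∀ x ∈ tsupport ψR, ∀ z ∈ closedBall (0 : ℝ³) (R * 2), ‖G (x - z)‖ ≤ CG :=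
      fun x hx z hz => hCG (x - z) ⟨(x, z), ⟨hx, hz⟩, rfl⟩
    set CG' := max CG 0 with hCG'def
    have hCGle : ∀ x ∈ tsupport ψR, ∀ z ∈ closedBall (0 : ℝ³) (R * 2), ‖G (x - z)‖ ≤ CG' :=
      fun x hx z hz => (hCG' x hx z hz).trans (le_max_left _ _)
    -- the Fubini integrand and its integrability on the product
    set F : ℝ³ → ℝ³ → ℝ := fun x z => ψR x * (newtonNear (R * 1) (R * 2) z * G (x - z)) with hF
    have hF_bound : ∀ x z, ‖F x z‖ ≤ (|ψR x| * CG') * |newtonNear (R * 1) (R * 2) z| := by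
      intro x z
      simp only [hF, Real.norm_eq_abs, abs_mul]
      by_cases hx : x ∈ tsupport ψR
      · by_cases hz : ‖z‖ ≤ R * 2
        · have := hCGle x hx z (mem_closedBall_zero_iff.2 hz)
          rw [Real.norm_eq_abs] at this
          calc |ψR x| * (|newtonNear (R * 1) (R * 2) z| * |G (x - z)|)
              ≤ |ψR x| * (|newtonNear (R * 1) (R * 2) z| * CG') := by gcongr
            _ = |ψR x| * CG' * |newtonNear (R * 1) (R * 2) z| := by ring
        · rw [newtonNear_eq_zero hR1.le hR2 (not_le.1 hz).le, abs_zero, zero_mul, mul_zero,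
            mul_zero]
      · rw [image_eq_zero_of_notMem_tsupport hx, abs_zero, zero_mul, zero_mul, zero_mul]
    have hF_meas : AEStronglyMeasurable (uncurry F) ((volume : Measure ℝ³).prod volume) := by
      refine Measurable.aestronglyMeasurable ?_
      exact (hψRcont.measurable.comp measurable_fst).mul
        (((measurable_newtonNear _ _).comp measurable_snd).mul
          (hGc.measurable.comp (measurable_fst.sub measurable_snd)))
    have hF_int : Integrable (uncurry F) ((volume : Measure ℝ³).prod volume) := by
      refine Integrable.mono' ?_ hF_meas (Eventually.of_forall fun q => hF_bound q.1 q.2)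
      exact ((hψRcont.abs.integrable_of_hasCompactSupport hψRc.abs).mul_const CG').mul_prod
        (integrable_newtonNear hR1.le hR2).abs
    -- Fubini
    have hswap : ∫ x, Q₁ x * ψR x =
        ∫ z, newtonNear (R * 1) (R * 2) z * ∫ x, ψR x * G (x - z) := by
      have e1 : (fun x => Q₁ x * ψR x) = fun x => ∫ z, F x z := by
        funext x
        rw [hQ₁, nearPotential, mul_comm, ← integral_const_mul]
      rw [e1, integral_integral_swap hF_int]
      refine integral_congr_ae (Eventually.of_forall fun z => ?_)
      show ∫ x, F x z = newtonNear (R * 1) (R * 2) z * ∫ x, ψR x * G (x - z)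
      rw [← integral_const_mul]
      refine integral_congr_ae (Eventually.of_forall fun x => ?_)
      simp only [hF]
      ring
    -- the local energy bound: on the ball `B(x₀, R(rψ'+2))`, `∫ |v|² ≤ C² |B|`
    set Bw : Set ℝ³ := closedBall x₀ (R * (rψ' + 2)) with hBw
    have hBw_fin : volume Bw < ⊤ := measure_closedBall_lt_top
    have hvolBw : volume.real Bw = (R * (rψ' + 2)) ^ 3 * V₁ := by
      rw [hV₁, hBw, measureReal_def, measureReal_def,
        Measure.addHaar_closedBall volume x₀ (by positivity : (0:ℝ) ≤ R * (rψ' + 2)),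
        Measure.addHaar_closedBall volume (0 : ℝ³) zero_le_one, ENNReal.toReal_mul,
        ENNReal.toReal_ofReal (by positivity)]
      simp
    -- the inner integral after two integrations by parts, for `|z| ≤ 2R`
    have hJ : ∀ z, ‖z‖ ≤ R * 2 → |∫ x, ψR x * G (x - z)| ≤ R⁻¹ ^ 2 * D₂ * (C ^ 2 * ((R * (rψ' + 2)) ^ 3 * V₁)) := by
      intro z hz
      have e1 : ∫ x, ψR x * G (x - z) = ∫ w, ψR (w + z) * G w := by
        rw [← integral_add_right_eq_self (fun x => ψR x * G (x - z)) z]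
        simp only [add_sub_cancel_right]
      have hθ : ContDiff ℝ 2 fun w => ψR (w + z) := hψRs.comp (contDiff_id.add contDiff_const)
      have hθc : HasCompactSupport fun w => ψR (w + z) :=
        hψRc.comp_homeomorph (Homeomorph.addRight z)
      have e2 : ∫ w, ψR (w + z) * G w = ∫ w, fderiv ℝ (fderiv ℝ ψR) (w + z) (v w) (v w) := by
        rw [hG, integral_mul_pressureSource hθ hθc hv2]
        refine integral_congr_ae (Eventually.of_forall fun w => ?_)
        have h1 : fderiv ℝ (fun w => ψR (w + z)) = fun w => fderiv ℝ ψR (w + z) :=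
          funext fun w => fderiv_comp_add_right z
        simp only [h1, fderiv_comp_add_right]
      rw [e1, e2, ← Real.norm_eq_abs]
      -- pointwise: the integrand vanishes off `Bw` and is `≤ R⁻² D₂ C²` on it
      have hpt : ∀ w, ‖fderiv ℝ (fderiv ℝ ψR) (w + z) (v w) (v w)‖ ≤
          R⁻¹ ^ 2 * D₂ * C ^ 2 * Bw.indicator (fun _ => (1 : ℝ)) w := by
        intro w
        by_cases hw : w ∈ Bw
        · rw [Set.indicator_of_mem hw, mul_one]
          have h1w : 0 < 1 + ‖w‖ := by positivity
          have hvw : ‖v w‖ ^ 2 ≤ C ^ 2 := by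
            have := pow_le_pow_left₀ (norm_nonneg _) (hv w) 2
            exact this.trans (by rw [div_pow]; exact div_le_self (sq_nonneg _) (one_le_pow₀ (by linarith [norm_nonneg w])))
          calc ‖fderiv ℝ (fderiv ℝ ψR) (w + z) (v w) (v w)‖
              ≤ ‖fderiv ℝ (fderiv ℝ ψR) (w + z) (v w)‖ * ‖v w‖ := ContinuousLinearMap.le_opNorm _ _
            _ ≤ ‖fderiv ℝ (fderiv ℝ ψR) (w + z)‖ * ‖v w‖ * ‖v w‖ := by
                gcongr; exact ContinuousLinearMap.le_opNorm _ _
            _ ≤ R⁻¹ ^ 2 * D₂ * ‖v w‖ * ‖v w‖ := by gcongr; exact hD2ψR _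
            _ = R⁻¹ ^ 2 * D₂ * ‖v w‖ ^ 2 := by ring
            _ ≤ R⁻¹ ^ 2 * D₂ * C ^ 2 := mul_le_mul_of_nonneg_left hvw (by positivity)
        · -- `w + z ∉ closedBall x₀ (R rψ')`, so `D²ψR (w + z) = 0`
          have hwz : w + z ∉ closedBall x₀ (R * rψ') := by
            intro hmem
            apply hw
            rw [mem_closedBall, dist_eq_norm] at hmem
            rw [hBw, mem_closedBall, dist_eq_norm]
            have : ‖w - x₀‖ ≤ ‖w + z - x₀‖ + ‖z‖ := by
              have := norm_sub_le (w + z - x₀) z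
              rwa [show w + z - x₀ - z = w - x₀ by abel] at this
            nlinarith
          rw [hsuppD2 (w + z) hwz, Set.indicator_of_notMem hw]
          simp
      have hle := norm_integral_le_of_norm_le
        ((((integrableOn_const hBw_fin.ne (C := (1 : ℝ))).integrable_indicator measurableSet_closedBall).const_mul
          (R⁻¹ ^ 2 * D₂ * C ^ 2))) (Eventually.of_forall hpt)
      rw [integral_const_mul, integral_indicator measurableSet_closedBall, setIntegral_const, smul_eq_mul, mul_one,
        hvolBw] at hle
      linarith [hle]
    -- combine with `|z| > 2R ⇒ Γ₀^R(z) = 0`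
    have hJ' : ∀ z, |newtonNear (R * 1) (R * 2) z| * |∫ x, ψR x * G (x - z)| ≤
        |newtonNear (R * 1) (R * 2) z| * (R⁻¹ ^ 2 * D₂ * (C ^ 2 * ((R * (rψ' + 2)) ^ 3 * V₁))) := by
      intro z
      by_cases hz : ‖z‖ ≤ R * 2
      · exact mul_le_mul_of_nonneg_left (hJ z hz) (abs_nonneg _)
      · rw [newtonNear_eq_zero hR1.le hR2 (not_le.1 hz).le, abs_zero, zero_mul, zero_mul]
    rw [hswap, ← Real.norm_eq_abs]
    calc ‖∫ z, newtonNear (R * 1) (R * 2) z * ∫ x, ψR x * G (x - z)‖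
        ≤ ∫ z, |newtonNear (R * 1) (R * 2) z| * (R⁻¹ ^ 2 * D₂ * (C ^ 2 * ((R * (rψ' + 2)) ^ 3 * V₁))) := by
          refine norm_integral_le_of_norm_le ((integrable_newtonNear hR1.le hR2).abs.mul_const _)
            (Eventually.of_forall fun z => ?_)
          rw [Real.norm_eq_abs, abs_mul]
          exact hJ' z
      _ = N₁ * D₂ * ((rψ' + 2) ^ 3 * V₁) * C ^ 2 * R ^ 3 := by
          rw [integral_mul_const, integral_abs_newtonNear_scale hR, hN₁]
          field_simp
  -- assembly
  have iQ₁n : Integrable fun x => -(Q₁ x * ψR x) := iQ₁.neg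
  rw [hQ, integral_sub iQ₁n iQ₂, integral_neg]
  calc |-(∫ x, Q₁ x * ψR x) - ∫ x, Q₂ x * ψR x|
      ≤ |∫ x, Q₁ x * ψR x| + |∫ x, Q₂ x * ψR x| := by
        rw [show -(∫ x, Q₁ x * ψR x) - ∫ x, Q₂ x * ψR x =
          -((∫ x, Q₁ x * ψR x) + ∫ x, Q₂ x * ψR x) by ring, abs_neg]
        exact abs_add_le _ _
    _ ≤ N₁ * D₂ * ((rψ' + 2) ^ 3 * V₁) * C ^ 2 * R ^ 3 + Kf * Pψ * C ^ 2 * R ^ 3 := add_le_add hnear hfar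
    _ = (Kf * Pψ + N₁ * D₂ * ((rψ' + 2) ^ 3 * V₁)) * C ^ 2 * R ^ 3 := by ring

end Duality

end PineauVicol2026

end Literature.Analysis.FluidPDE
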